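import Summits.ResolutionOfSingularities.ResolutionOfSingularities.Theorems.WildQuotientsSummitReductionStubPairQuasiSplitBaseChangeAlgebra
import Summits.ResolutionOfSingularities.ResolutionOfSingularities.Theorems.WildQuotientsSummitReductionStubPairQuasiSplitBaseChangeLemmas
import Summits.ResolutionOfSingularities.ResolutionOfSingularities.Theorems.WildQuotientsSummitReductionStubPairQuasiSplitBaseChangeLemmas2
import HarnessLib

/-!
# `WildQuotients.SummitReduction` (stmt-ResolutionOfSingularities-16324), line `FramePerfect`:
# quasi-splitness at a point of an affine chart of a fibre product — the transfer theorem of stub `stub_pair_quasiSplitBaseChange`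

Route `ResolutionOfSingularities/WildQuotients`, crux `SummitReduction`; fifth helper file of stub
`stub_pair_quasiSplitBaseChange` (quasi-splitness of a semi-stable curve is stable under base
change; de Jong 1997, 5.7 and p. 614–615: the singular points of the fibres are rational with
rational tangents, "obviously stable under extension of the base") of the line skeleton
`Cruxes/SummitReduction/Lines/FramePerfect.lean` (v8). It assembles the algebra
(`…QuasiSplitBaseChangeAlgebra`: `(κ' ⊗_κ B)^ ≅ κ'⟦u,v⟧/(uv)` over `κ'` when `B^ ≅ κ⟦u,v⟧/(uv)` over
`κ`; `…Lemmas2`: the fibre ring `B'` of the base change is the localisation of `κ' ⊗_κ B` at the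
maximal ideal `𝔫(κ' ⊗_κ B)`) with the scheme lemmas (`…Lemmas`: the affine chart of `X ×_Y Y'`
through a point and the stalks along it). Hypothesis-free:

* `exists_adicCompletion_equiv_nodeQuot_fibreRing` — the statement in pure commutative algebra: for a
  commutative square of local homomorphisms `R → O → O' ← R' ← R` whose corners are localisations
  of rings of sections `C`, `A'`, `C ⊗_A A'` compatibly, `(O/𝔪_R O)^ ≅ κ⟦u,v⟧/(uv)` over `κ` gives
  `(O'/𝔪_{R'} O')^ ≅ κ'⟦u,v⟧/(uv)` over `κ'`;
* `exists_adicCompletion_equiv_of_affineChart` (entry theorem) — **quasi-splitness passes from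
  `x = p₁ x'` to `x'` for every point `x'` of an affine chart
  `Spec (Γ(X,U) ⊗_{Γ(Y,V)} Γ(Y',V')) → P` of a commutative square `P ⇉ X, Y' ⇉ Y`** (for
  `P = X ×_Y Y'`: every point lies in such a chart, `exists_affineChart_pullback`).
-/

set_option linter.dupNamespace false

noncomputable section

open CategoryTheory CategoryTheory.Limits AlgebraicGeometry TopologicalSpace TensorProduct
open Literature.AlgebraicGeometry.Resolution

namespace Summit.ResolutionOfSingularities.ResolutionOfSingularities.Theorems

open IsLocalRing

universe u

section Algebra

variable {A C A' : Type u} [CommRing A] [CommRing C] [CommRing A'] [Algebra A C] [Algebra A A']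
  {R O R' O' : Type u} [CommRing R] [CommRing O] [CommRing R'] [CommRing O']
  [IsLocalRing R] [IsLocalRing O] [IsLocalRing R'] [IsLocalRing O'] [IsNoetherianRing O]
  (φ : R →+* O) (ρ : R →+* R') (φ' : R' →+* O') (π : O →+* O')
  [IsLocalHom φ] [IsLocalHom ρ] [IsLocalHom φ'] [IsLocalHom π]
  (γA : A →+* R) (γC : C →+* O) (γA' : A' →+* R') (σ : C ⊗[A] A' →+* O')
  (hsq : ∀ r, φ' (ρ r) = π (φ r))
  (h0a : ∀ a, γC (algebraMap A C a) = φ (γA a)) (h0b : ∀ a, γA' (algebraMap A A' a) = ρ (γA a))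
  (h1 : ∀ c, σ (c ⊗ₜ 1) = π (γC c)) (h2 : ∀ a', σ (1 ⊗ₜ a') = φ' (γA' a'))
  (hO : ∀ o : O, ∃ c₁ c₂ : C, IsUnit (γC c₂) ∧ o * γC c₂ = γC c₁)
  (hR' : ∀ r : R', ∃ a₁ a₂ : A', IsUnit (γA' a₂) ∧ r * γA' a₂ = γA' a₁)
  (hR'' : maximalIdeal R' ≤ ((maximalIdeal R').comap γA').map γA')
  (hO'₁ : ∀ o : O', ∃ s u, IsUnit (σ u) ∧ o * σ u = σ s)
  (hO'₂ : ∀ (I : Ideal (C ⊗[A] A')) (s), σ s ∈ I.map σ → ∃ u, IsUnit (σ u) ∧ u * s ∈ I)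

include hsq h0a h0b h1 h2 hO hR' hR'' hO'₁ hO'₂ in
/-- **The completed fibre local ring of a base change, from an affine chart** (the algebra of
de Jong 1997, p. 614–615: "the singular points of the fibres are rational with rational tangents",
which is stable under extension of the base). Let `R → O`, `R → R'`, `R' → O'`, `O → O'` be local
homomorphisms of local rings forming a commutative square (`R = 𝒪_y`, `O = 𝒪_x`, `R' = 𝒪_{y'}`,
`O' = 𝒪_{x'}` for a point `x'` of `X ×_Y Y'`), with `O`, `R'`, `O'` localisations of rings of
sections `C`, `A'`, `C ⊗_A A'` compatibly with these maps (hypotheses `hO`, `hR'`, `hR''`, `hO'₁`,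
`hO'₂`, `h0a`, `h0b`, `h1`, `h2`). If the fibre ring `B = O/𝔪_R O` has `𝔪`-adic completion
`κ⟦u,v⟧/(uv)` compatibly with `κ = R/𝔪_R`, then the fibre ring `B' = O'/𝔪_{R'} O'` has `𝔪`-adic
completion `κ'⟦u,v⟧/(uv)` compatibly with `κ' = R'/𝔪_{R'}`: `B'` is the localisation of `κ' ⊗_κ B`
at the maximal ideal `𝔫(κ' ⊗_κ B)` (`exists_isLocalization_fibreRing`,
`isMaximal_map_tensorInr_of_completion_equiv`), whose completion is `κ'⟦u,v⟧/(uv)` over `κ'`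
(`exists_completion_tensor_equiv_nodeQuot`, `exists_adicCompletion_fibreRing_equiv`).
[cite: DeJong1997, 5.7 and p. 614–615] -/
theorem exists_adicCompletion_equiv_nodeQuot_fibreRing
    (ex : AdicCompletion ((maximalIdeal O).map (Ideal.Quotient.mk ((maximalIdeal R).map φ)))
        (O ⧸ (maximalIdeal R).map φ) ≃+*
      MvPowerSeries (Fin 2) (R ⧸ maximalIdeal R) ⧸ Ideal.span {(MvPowerSeries.X 0 * MvPowerSeries.X 1 :
        MvPowerSeries (Fin 2) (R ⧸ maximalIdeal R))})
    (hex : ex.toRingHom.comp ((algebraMap (O ⧸ (maximalIdeal R).map φ) _).comp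
        (Ideal.quotientMap ((maximalIdeal R).map φ) φ Ideal.le_comap_map)) =
      algebraMap (R ⧸ maximalIdeal R) _) :
    ∃ e : AdicCompletion ((maximalIdeal O').map (Ideal.Quotient.mk ((maximalIdeal R').map φ')))
        (O' ⧸ (maximalIdeal R').map φ') ≃+*
      MvPowerSeries (Fin 2) (R' ⧸ maximalIdeal R') ⧸ Ideal.span {(MvPowerSeries.X 0 * MvPowerSeries.X 1 :
        MvPowerSeries (Fin 2) (R' ⧸ maximalIdeal R'))},
      e.toRingHom.comp ((algebraMap (O' ⧸ (maximalIdeal R').map φ') _).comp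
        (Ideal.quotientMap ((maximalIdeal R').map φ') φ' Ideal.le_comap_map)) =
      algebraMap (R' ⧸ maximalIdeal R') _ := by
  have hρ : maximalIdeal R ≤ (maximalIdeal R').comap ρ := ((local_hom_TFAE ρ).out 0 3).mp ‹IsLocalHom ρ›
  letI fκ : Field (R ⧸ maximalIdeal R) := Ideal.Quotient.field _
  letI fκ' : Field (R' ⧸ maximalIdeal R') := Ideal.Quotient.field _
  letI aκκ' : Algebra (R ⧸ maximalIdeal R) (R' ⧸ maximalIdeal R') := (Ideal.quotientMap _ ρ hρ).toAlgebra
  letI aκB : Algebra (R ⧸ maximalIdeal R) (O ⧸ (maximalIdeal R).map φ) :=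
    (Ideal.quotientMap _ φ Ideal.le_comap_map).toAlgebra
  letI aκ'B' : Algebra (R' ⧸ maximalIdeal R') (O' ⧸ (maximalIdeal R').map φ') :=
    (Ideal.quotientMap _ φ' Ideal.le_comap_map).toAlgebra
  letI aκB' : Algebra (R ⧸ maximalIdeal R) (O' ⧸ (maximalIdeal R').map φ') :=
    ((algebraMap (R' ⧸ maximalIdeal R') (O' ⧸ (maximalIdeal R').map φ')).comp
      (algebraMap (R ⧸ maximalIdeal R) (R' ⧸ maximalIdeal R'))).toAlgebra
  haveI : IsScalarTower (R ⧸ maximalIdeal R) (R' ⧸ maximalIdeal R') (O' ⧸ (maximalIdeal R').map φ') :=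
    IsScalarTower.of_algebraMap_eq (fun _ => rfl)
  -- `B'` and `B` are local, with local quotient maps
  have hI' : (maximalIdeal R').map φ' ≠ ⊤ := fun htop => by
    have hle : (maximalIdeal R').map φ' ≤ maximalIdeal O' := ((local_hom_TFAE φ').out 0 2).mp ‹IsLocalHom φ'›
    rw [htop, top_le_iff] at hle
    exact (maximalIdeal.isMaximal _).ne_top hle
  haveI : Nontrivial (O' ⧸ (maximalIdeal R').map φ') := Ideal.Quotient.nontrivial_iff.mpr hI'
  haveI : IsLocalRing (O' ⧸ (maximalIdeal R').map φ') :=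
    IsLocalRing.of_surjective' (Ideal.Quotient.mk _) Ideal.Quotient.mk_surjective
  haveI hmk'loc : IsLocalHom (Ideal.Quotient.mk ((maximalIdeal R').map φ')) :=
    IsLocalHom.of_surjective _ Ideal.Quotient.mk_surjective
  have hI : (maximalIdeal R).map φ ≠ ⊤ := fun htop => by
    have hle : (maximalIdeal R).map φ ≤ maximalIdeal O := ((local_hom_TFAE φ).out 0 2).mp ‹IsLocalHom φ›
    rw [htop, top_le_iff] at hle
    exact (maximalIdeal.isMaximal _).ne_top hle
  haveI : Nontrivial (O ⧸ (maximalIdeal R).map φ) := Ideal.Quotient.nontrivial_iff.mpr hI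
  haveI : IsLocalRing (O ⧸ (maximalIdeal R).map φ) :=
    IsLocalRing.of_surjective' (Ideal.Quotient.mk _) Ideal.Quotient.mk_surjective
  haveI hmkloc : IsLocalHom (Ideal.Quotient.mk ((maximalIdeal R).map φ)) :=
    IsLocalHom.of_surjective _ Ideal.Quotient.mk_surjective
  -- `β : B → B'`
  have hle : (maximalIdeal R).map φ ≤ ((maximalIdeal R').map φ').comap π := by
    rw [Ideal.map_le_iff_le_comap]
    intro r hr
    rw [Ideal.mem_comap, Ideal.mem_comap, ← hsq]
    exact Ideal.mem_map_of_mem φ' (hρ hr)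
  -- `𝔫 = 𝔪_x B` is maximal
  haveI h𝔫 : ((maximalIdeal O).map (Ideal.Quotient.mk ((maximalIdeal R).map φ))).IsMaximal := by
    refine (Ideal.map_eq_top_or_isMaximal_of_surjective (Ideal.Quotient.mk ((maximalIdeal R).map φ))
      Ideal.Quotient.mk_surjective (maximalIdeal.isMaximal _)).resolve_left fun htop => ?_
    have hle' : (maximalIdeal O).map (Ideal.Quotient.mk ((maximalIdeal R).map φ)) ≤ maximalIdeal _ :=
      ((local_hom_TFAE (Ideal.Quotient.mk ((maximalIdeal R).map φ))).out 0 2).mp hmkloc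
    rw [htop, top_le_iff] at hle'
    exact (maximalIdeal.isMaximal _).ne_top hle'
  -- the hypothesis at `x`, in the form of the algebra files
  have hex' : ∀ c : R ⧸ maximalIdeal R, ex (algebraMap (R ⧸ maximalIdeal R) _ c) = algebraMap _ _ c := by
    intro c
    have h := RingHom.congr_fun hex c
    rw [RingHom.comp_apply, RingHom.comp_apply] at h
    rw [IsScalarTower.algebraMap_apply (R ⧸ maximalIdeal R) (O ⧸ (maximalIdeal R).map φ) (AdicCompletion _ _)]
    exact h
  have hP := isMaximal_map_tensorInr_of_completion_equiv (R' ⧸ maximalIdeal R') _ ex hex'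
  obtain ⟨e', he'⟩ := exists_completion_tensor_equiv_nodeQuot (R' ⧸ maximalIdeal R') _ ex hex'
  -- the transfer
  obtain ⟨e, he⟩ := exists_adicCompletion_fibreRing_equiv φ ρ φ' π γA γC γA' σ (Ideal.Quotient.mk _)
    (Ideal.Quotient.mk _) (Ideal.Quotient.mk _) (Ideal.Quotient.mk _) (Ideal.quotientMap _ π hle)
    hsq h0a h0b h1 h2 hO hR' hR'' hO'₁ hO'₂
    Ideal.Quotient.mk_surjective Ideal.Quotient.mk_surjective
    (fun r hr => Ideal.Quotient.eq_zero_iff_mem.mpr hr) Ideal.Quotient.mk_surjective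
    Ideal.Quotient.mk_surjective (fun o ho => Ideal.Quotient.eq_zero_iff_mem.mp ho) (fun _ => rfl)
    (fun _ => rfl) (fun _ => rfl) (fun _ => rfl) hP e' he'
  exact ⟨e, RingHom.ext fun c => he c⟩

end Algebra

section Transfer

/-- **Quasi-splitness passes to a fibre product, at a point of an affine chart.** Let
`p₁ : P → X`, `p₂ : P → Y'` and `f : X → Y`, `ψ : Y' → Y` form a commutative square, and let
`χ : Spec (Γ(X,U) ⊗_{Γ(Y,V)} Γ(Y',V')) → P` be an open immersion with
`χ ≫ p₁ = Spec (c ↦ c ⊗ 1) ≫ (Spec Γ(X,U) → X)` and `χ ≫ p₂ = Spec (a' ↦ 1 ⊗ a') ≫ (Spec Γ(Y',V') → Y')`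
(affine opens `U ⊆ f⁻¹V`, `V' ⊆ ψ⁻¹V` over an affine open `V`, the algebra structures being the
restriction maps; for `P = X ×_Y Y'` this is `exists_affineChart_pullback`). If at `x = p₁ (χ t)` the
completed fibre local ring `(𝒪_x/𝔪_{f x}𝒪_x)^` is `κ(f x)⟦u,v⟧/(uv)` compatibly with `κ(f x)`, then at
`χ t` the completed fibre local ring `(𝒪_{χ t}/𝔪_{y'}𝒪_{χ t})^`, `y' = p₂ (χ t)`, is
`κ(y')⟦u,v⟧/(uv)` compatibly with `κ(y')`: the stalks are localisations of the sections
(`exists_germ_mul_eq_germ`, `isLocalization_stalk_of_isIso_stalkMap`) compatibly with the stalk maps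
(`germ_stalkMap_stalkMap_eq_germ_of_comp_eq`, `germ_appLE_apply`), so
`exists_adicCompletion_equiv_nodeQuot_fibreRing` applies. [cite: DeJong1997, 5.7 and p. 614–615] -/
theorem exists_adicCompletion_equiv_of_affineChart {X Y Y' P : Scheme.{0}} [IsLocallyNoetherian X]
    (p₁ : P ⟶ X) (p₂ : P ⟶ Y') (f : X ⟶ Y) (ψ : Y' ⟶ Y) (hsqP : p₁ ≫ f = p₂ ≫ ψ)
    {V : Y.Opens} {U : X.Opens} (hU : IsAffineOpen U) (hUV : U ≤ f ⁻¹ᵁ V)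
    {V' : Y'.Opens} (hV' : IsAffineOpen V') (hV'V : V' ≤ ψ ⁻¹ᵁ V)
    [Algebra Γ(Y, V) Γ(X, U)] [Algebra Γ(Y, V) Γ(Y', V')]
    (hC : algebraMap Γ(Y, V) Γ(X, U) = (f.appLE V U hUV).hom)
    (hA' : algebraMap Γ(Y, V) Γ(Y', V') = (ψ.appLE V V' hV'V).hom)
    (χ : Spec (.of (Γ(X, U) ⊗[Γ(Y, V)] Γ(Y', V'))) ⟶ P) [IsOpenImmersion χ]
    (t : Spec (.of (Γ(X, U) ⊗[Γ(Y, V)] Γ(Y', V'))))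
    (hS1 : χ ≫ p₁ = Spec.map (CommRingCat.ofHom
        (Algebra.TensorProduct.includeLeftRingHom : Γ(X, U) →+* Γ(X, U) ⊗[Γ(Y, V)] Γ(Y', V'))) ≫
          hU.fromSpec)
    (hS2 : χ ≫ p₂ = Spec.map (CommRingCat.ofHom
        ((Algebra.TensorProduct.includeRight :
          Γ(Y', V') →ₐ[Γ(Y, V)] Γ(X, U) ⊗[Γ(Y, V)] Γ(Y', V'))).toRingHom) ≫ hV'.fromSpec)
    (ex : AdicCompletion
            ((maximalIdeal (X.presheaf.stalk (p₁ (χ t)))).map (Ideal.Quotient.mk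
              ((maximalIdeal (Y.presheaf.stalk (f (p₁ (χ t))))).map (f.stalkMap (p₁ (χ t))).hom)))
            (X.presheaf.stalk (p₁ (χ t)) ⧸
              (maximalIdeal (Y.presheaf.stalk (f (p₁ (χ t))))).map (f.stalkMap (p₁ (χ t))).hom) ≃+*
          MvPowerSeries (Fin 2) (Y.presheaf.stalk (f (p₁ (χ t))) ⧸ maximalIdeal (Y.presheaf.stalk (f (p₁ (χ t))))) ⧸
            Ideal.span {(MvPowerSeries.X 0 * MvPowerSeries.X 1 :
              MvPowerSeries (Fin 2) (Y.presheaf.stalk (f (p₁ (χ t))) ⧸ maximalIdeal (Y.presheaf.stalk (f (p₁ (χ t))))))})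
    (hex : ex.toRingHom.comp ((algebraMap (X.presheaf.stalk (p₁ (χ t)) ⧸
              (maximalIdeal (Y.presheaf.stalk (f (p₁ (χ t))))).map (f.stalkMap (p₁ (χ t))).hom) _).comp
            (Ideal.quotientMap ((maximalIdeal (Y.presheaf.stalk (f (p₁ (χ t))))).map (f.stalkMap (p₁ (χ t))).hom)
              (f.stalkMap (p₁ (χ t))).hom Ideal.le_comap_map)) =
          algebraMap (Y.presheaf.stalk (f (p₁ (χ t))) ⧸ maximalIdeal (Y.presheaf.stalk (f (p₁ (χ t))))) _) :
    ∃ e : AdicCompletion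
          ((maximalIdeal (P.presheaf.stalk (χ t))).map (Ideal.Quotient.mk
            ((maximalIdeal (Y'.presheaf.stalk (p₂ (χ t)))).map (p₂.stalkMap (χ t)).hom)))
          (P.presheaf.stalk (χ t) ⧸
            (maximalIdeal (Y'.presheaf.stalk (p₂ (χ t)))).map (p₂.stalkMap (χ t)).hom) ≃+*
        MvPowerSeries (Fin 2) (Y'.presheaf.stalk (p₂ (χ t)) ⧸ maximalIdeal (Y'.presheaf.stalk (p₂ (χ t)))) ⧸
          Ideal.span {(MvPowerSeries.X 0 * MvPowerSeries.X 1 :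
            MvPowerSeries (Fin 2) (Y'.presheaf.stalk (p₂ (χ t)) ⧸ maximalIdeal (Y'.presheaf.stalk (p₂ (χ t)))))},
        e.toRingHom.comp ((algebraMap (P.presheaf.stalk (χ t) ⧸
            (maximalIdeal (Y'.presheaf.stalk (p₂ (χ t)))).map (p₂.stalkMap (χ t)).hom) _).comp
          (Ideal.quotientMap ((maximalIdeal (Y'.presheaf.stalk (p₂ (χ t)))).map (p₂.stalkMap (χ t)).hom)
            (p₂.stalkMap (χ t)).hom Ideal.le_comap_map)) =
        algebraMap (Y'.presheaf.stalk (p₂ (χ t)) ⧸ maximalIdeal (Y'.presheaf.stalk (p₂ (χ t)))) _ := by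
  have hxU : p₁ (χ t) ∈ U := apply_apply_mem_of_comp_eq χ p₁ hU _ hS1 t
  have hy'V' : p₂ (χ t) ∈ V' := apply_apply_mem_of_comp_eq χ p₂ hV' _ hS2 t
  have hyV : f (p₁ (χ t)) ∈ V := hUV hxU
  have hyy : f (p₁ (χ t)) = ψ (p₂ (χ t)) := by
    rw [← Scheme.Hom.comp_apply, hsqP, Scheme.Hom.comp_apply]
  -- the maps between the local rings
  let φ : (Y.presheaf.stalk (f (p₁ (χ t))) : Type) →+* X.presheaf.stalk (p₁ (χ t)) :=
    (f.stalkMap (p₁ (χ t))).hom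
  let π : (X.presheaf.stalk (p₁ (χ t)) : Type) →+* P.presheaf.stalk (χ t) := (p₁.stalkMap (χ t)).hom
  let φ' : (Y'.presheaf.stalk (p₂ (χ t)) : Type) →+* P.presheaf.stalk (χ t) := (p₂.stalkMap (χ t)).hom
  let ρ : (Y.presheaf.stalk (f (p₁ (χ t))) : Type) →+* Y'.presheaf.stalk (p₂ (χ t)) :=
    (ψ.stalkMap (p₂ (χ t))).hom.comp (Y.presheaf.stalkCongr (.of_eq hyy)).hom.hom
  have hsq : ∀ r, φ' (ρ r) = π (φ r) := by
    intro r
    have h := Scheme.Hom.stalkMap_congr_hom _ _ hsqP (χ t)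
    rw [Scheme.Hom.stalkMap_comp, Scheme.Hom.stalkMap_comp] at h
    have h' := congrArg (fun q => q.hom r) h
    simp only [CommRingCat.hom_comp, RingHom.coe_comp, Function.comp_apply] at h'
    exact h'.symm
  -- the sections and the germ maps
  let S : Type := Γ(X, U) ⊗[Γ(Y, V)] Γ(Y', V')
  let γA : (Γ(Y, V) : Type) →+* Y.presheaf.stalk (f (p₁ (χ t))) := (Y.presheaf.germ V _ hyV).hom
  let γC : (Γ(X, U) : Type) →+* X.presheaf.stalk (p₁ (χ t)) := (X.presheaf.germ U _ hxU).hom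
  let γA' : (Γ(Y', V') : Type) →+* Y'.presheaf.stalk (p₂ (χ t)) := (Y'.presheaf.germ V' _ hy'V').hom
  let σ : S →+* P.presheaf.stalk (χ t) := (inv (χ.stalkMap t)).hom.comp
    ((Scheme.ΓSpecIso (.of S)).inv ≫ (Spec (.of S)).presheaf.germ ⊤ t trivial).hom
  have h0a : ∀ a, γC (algebraMap Γ(Y, V) Γ(X, U) a) = φ (γA a) := fun a => by
    rw [hC]
    exact germ_appLE_apply f hUV hxU a
  have h0b : ∀ a, γA' (algebraMap Γ(Y, V) Γ(Y', V') a) = ρ (γA a) := fun a => by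
    rw [hA']
    change _ = (ψ.stalkMap (p₂ (χ t))).hom ((Y.presheaf.stalkCongr (.of_eq hyy)).hom.hom
        ((Y.presheaf.germ V _ hyV).hom a))
    rw [stalkCongr_germ_apply hyy hyV a]
    exact germ_appLE_apply ψ hV'V hy'V' a
  have h1 : ∀ c, σ (c ⊗ₜ 1) = π (γC c) := fun c => by
    have h := congrArg (inv (χ.stalkMap t)).hom
      (stalkMap_stalkMap_germ_eq_germ_of_comp_eq χ p₁ hU _ hS1 t hxU c)
    rw [inv_stalkMap_apply] at h
    exact h.symm
  have h2 : ∀ a', σ (1 ⊗ₜ a') = φ' (γA' a') := fun a' => by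
    have h := congrArg (inv (χ.stalkMap t)).hom
      (stalkMap_stalkMap_germ_eq_germ_of_comp_eq χ p₂ hV' _ hS2 t hy'V' a')
    rw [inv_stalkMap_apply] at h
    exact h.symm
  -- the local rings are localisations of the sections
  have hO : ∀ o : X.presheaf.stalk (p₁ (χ t)), ∃ c₁ c₂ : Γ(X, U), IsUnit (γC c₂) ∧ o * γC c₂ = γC c₁ :=
    exists_germ_mul_eq_germ hU hxU
  have hR' : ∀ r : Y'.presheaf.stalk (p₂ (χ t)), ∃ a₁ a₂ : Γ(Y', V'),
      IsUnit (γA' a₂) ∧ r * γA' a₂ = γA' a₁ :=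
    exists_germ_mul_eq_germ hV' hy'V'
  have hR'' : maximalIdeal (Y'.presheaf.stalk (p₂ (χ t))) ≤
      ((maximalIdeal (Y'.presheaf.stalk (p₂ (χ t)))).comap γA').map γA' :=
    maximalIdeal_le_map_comap_germ hV' hy'V'
  have hO'₁ : ∀ o : P.presheaf.stalk (χ t), ∃ s u, IsUnit (σ u) ∧ o * σ u = σ s :=
    exists_mul_eq_of_isIso_stalkMap χ t
  have hO'₂ : ∀ (I : Ideal S) (s), σ s ∈ I.map σ → ∃ u, IsUnit (σ u) ∧ u * s ∈ I :=
    exists_isUnit_mul_mem_of_isIso_stalkMap χ t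
  -- Step 4: the algebra
  haveI hφloc : IsLocalHom φ := inferInstanceAs (IsLocalHom (f.stalkMap (p₁ (χ t))).hom)
  haveI hφ'loc : IsLocalHom φ' := inferInstanceAs (IsLocalHom (p₂.stalkMap (χ t)).hom)
  haveI hπloc : IsLocalHom π := inferInstanceAs (IsLocalHom (p₁.stalkMap (χ t)).hom)
  haveI : IsLocalHom (Y.presheaf.stalkCongr (X := Y) (Inseparable.of_eq hyy)).hom.hom := isLocalHom_of_isIso _
  haveI hρloc : IsLocalHom ρ := RingHom.isLocalHom_comp _ _
  exact exists_adicCompletion_equiv_nodeQuot_fibreRing φ ρ φ' π γA γC γA' σ hsq h0a h0b h1 h2 hO hR' hR''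
    hO'₁ hO'₂ ex hex

end Transfer

end Summit.ResolutionOfSingularities.ResolutionOfSingularities.Theorems

end
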